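import Summits.Ventures.PercRepro.Night2SevenFiveResiduesB
import Summits.Ventures.PercRepro.Night2ExcessCellsE
import Summits.Ventures.PercRepro.Night2ExcessCellsF

/-!
# PercRepro — the `(7, 5)` shadow row modulo the residues, with spread basis members (night-2, gen 20)

`shadowHall_seven_five_of_residuesB` plus the `m₂`-chord cells (`Night2ExcessCellsE`, `Night2ExcessCellsF`):
**`shadowHall_seven_five_of_residuesC`** = ShadowHall M 7 5 (phiK 7 5) for every finite matroid modulo
* `(2, 0)`: fat 6/3 ∧ (basis 2 ∨ fat 6/2)                       [B: basis 3 ∨ fat 6/2];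
* `(2, 1)`: fat 5/4 ∧ (basis 3 ∨ fat 5/3);
* `(3, 0)`: `10 ≤ |G| ≤ 13` ∧ fat 6/2 ∧ basis 2;
* `(3, 1)`: `10 ≤ |G| ≤ 17` ∧ fat 5/2 ∧ basis 2 at `|G| ∈ {10, 17}`, basis 3 at `|G| ∈ {11, 15, 16}`, basis 4 at
  `12 ≤ |G| ≤ 14`                                                [B: basis 4 throughout];
* `(3, 2)`: fat 4/2
(«fat a/m» = a thin member with `|B ∖ K| ≥ a` missing `≤ m` points, «basis m» = a hyperplane-basis member missing
`≤ m`).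
-/

namespace PercRepro.Shadow

open Finset PerFlat ThmH

section SevenFiveC

variable {α' : Type} [DecidableEq α']

/-- **THE `(7, 5)` SHADOW ROW FOR EVERY FINITE MATROID MODULO THE RESIDUES WITH SPREAD BASIS MEMBERS** (see the
module docstring for the five residues). -/
theorem shadowHall_seven_five_of_residuesC
    (h20 : ∀ (N : Matroid α') [N.Finite] (G : Finset α'), CellHyp N G →
      (gr N \ G).card = 2 → kColoops N G = 0 → FatMember N G 6 3 →
      (FatBasis N G 6 2 ∨ FatMember N G 6 2) → LocalShadowHall N 5 G)
    (h21 : ∀ (N : Matroid α') [N.Finite] (G : Finset α'), CellHyp N G →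
      (gr N \ G).card = 2 → kColoops N G = 1 → FatMember N G 5 4 →
      (FatBasis N G 5 3 ∨ FatMember N G 5 3) → LocalShadowHall N 5 G)
    (h30 : ∀ (N : Matroid α') [N.Finite] (G : Finset α'), CellHyp N G →
      (gr N \ G).card = 3 → kColoops N G = 0 → 10 ≤ G.card → G.card ≤ 13 → FatMember N G 6 2 →
      FatBasis N G 6 2 → LocalShadowHall N 5 G)
    (h31 : ∀ (N : Matroid α') [N.Finite] (G : Finset α'), CellHyp N G →
      (gr N \ G).card = 3 → kColoops N G = 1 → 10 ≤ G.card → G.card ≤ 17 → FatMember N G 5 2 →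
      (G.card = 10 ∨ G.card = 17 → FatBasis N G 5 2) →
      (G.card = 11 ∨ G.card = 15 ∨ G.card = 16 → FatBasis N G 5 3) →
      (12 ≤ G.card ∧ G.card ≤ 14 → FatBasis N G 5 4) → LocalShadowHall N 5 G)
    (h32 : ∀ (N : Matroid α') [N.Finite] (G : Finset α'), CellHyp N G →
      (gr N \ G).card = 3 → kColoops N G = 2 → FatMember N G 4 2 → LocalShadowHall N 5 G)
    (M : Matroid α') [M.Finite] : ShadowHall M 7 5 (phiK 7 5) := by
  apply shadowHall_seven_five_of_residuesB
  · -- (2, 0)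
    intro N _ G hcell hd hk hpa hs2
    rcases hs2 with hb3 | hf2
    · by_cases hb2 : FatBasis N G 6 2
      · exact h20 N G hcell hd hk hpa (Or.inl hb2)
      · by_cases hf2 : FatMember N G 6 2
        · exact h20 N G hcell hd hk hpa (Or.inr hf2)
        · push Not at hb2 hf2
          exact localShadowHall_two_zero_five_of_excess_m2 hcell.2.2.2 hd hk hcell.1 hcell.2.1
            (fun B hB h6 => by have := hf2 B hB h6; omega)
            (fun B hB h6 => by have := hb2 B hB h6; omega)
    · exact h20 N G hcell hd hk hpa (Or.inr hf2)
  · -- (2, 1)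
    intro N _ G hcell hd hk hpa hs2
    exact h21 N G hcell hd hk hpa hs2
  · -- (3, 0)
    intro N _ G hcell hd hk h10 h13 hpa hb
    exact h30 N G hcell hd hk h10 h13 hpa hb
  · -- (3, 1)
    intro N _ G hcell hd hk h10 h17 hpa hb4
    have hG := hcell.2.2.2
    have hs := hcell.1
    have hl := hcell.2.1
    rcases (by omega : (G.card = 10 ∨ G.card = 17) ∨ (G.card = 11 ∨ G.card = 15 ∨ G.card = 16) ∨
        (12 ≤ G.card ∧ G.card ≤ 14)) with hc1 | hc2 | hc3
    · by_cases hb : FatBasis N G 5 2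
      · exact h31 N G hcell hd hk h10 h17 hpa (fun _ => hb) (fun h => absurd h (by omega))
          (fun h => absurd h (by omega))
      · push Not at hb
        exact localShadowHall_three_one_five_of_excess_m2 hG hd hk hs hl h10 h17
          (fun _ B hB h5 => by have := hb B hB h5; omega) (fun h => absurd h (by omega))
          (fun h => absurd h (by omega))
    · by_cases hb : FatBasis N G 5 3
      · exact h31 N G hcell hd hk h10 h17 hpa (fun h => absurd h (by omega)) (fun _ => hb)
          (fun h => absurd h (by omega))
      · push Not at hb
        exact localShadowHall_three_one_five_of_excess_m2 hG hd hk hs hl h10 h17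
          (fun h => absurd h (by omega)) (fun _ B hB h5 => by have := hb B hB h5; omega)
          (fun h => absurd h (by omega))
    · exact h31 N G hcell hd hk h10 h17 hpa (fun h => absurd h (by omega)) (fun h => absurd h (by omega))
        (fun _ => hb4)
  · -- (3, 2)
    intro N _ G hcell hd hk hpa
    exact h32 N G hcell hd hk hpa

end SevenFiveC

end PercRepro.Shadow
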